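import Mathlib
import HarnessLib
import Summits.Parity.GeneralizedHardyLittlewood.Theses.LeeYangFibres
import Summits.Parity.GeneralizedHardyLittlewood.Theorems.LeeYangFibresAbsoluteUpgradeDipDefs

/-!
# Route `LeeYangFibres`, crux `FibreHyperbolicityAlong` (stmt-Parity-18103): vocabulary of the line
# `sifted-chowla-distillation`

Route-posited objects and STATEMENTS (D-0016 `<Route><Crux>Defs` file) shared by the registered stubs of the
skeleton `Cruxes/FibreHyperbolicityAlong/Lines/sifted_chowla_distillation.lean` (crux-strategist
`planner-cstrat-stmt-Parity-18103-0`, RESHAPED to seven stubs by the line lead `prover-line-stmt-Parity-18103-0`,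
2026-08-17) and by the files that prove and compose them.  Nothing is asserted: every `def … : Prop` below is a
STATEMENT (the type of a registered stub, or of a hypothesis of one), consumed only as such; the four small
theorems (`rowTol_of_ne`, `rowTol_self`, `siftedLiouvilleCorr_empty`, `jointCell_eq_nlc`) are proved sanity lemmas
about the objects, and the registered bookkeeping stub `stub_glueAlong` (the line's composition, pure logic in the
statement names) is proved at the end.

The line (one paragraph).  Along the schedule `u = U(N) = slowDegree N = max 4 ⌊√(log log N)/2⌋` every
coefficient-based proof of the crux is a race between the relative accuracy to which the fibre coefficients — the
joint rough cells `C_j` — are known and the real-rootedness robustness radius of the Buchstab–Dickman row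
`F_U(ζ) = Σ_m I_m(U) ζ^m` (`I_m(U) = cellDensity (m-1) U`).  By the route's cell-parity law (item stmt-Parity-18104)
the cells equal the rank-one model up to the `2^t − 1` Walsh amplitudes `θ_S`, and `θ_S` is, by Walsh inversion over
the parity classes, the normalised SIFTED LIOUVILLE CORRELATION `Σ_{n : every ψ_k(n) N^{1/U}-rough} ∏_{i∈S} λ(ψ_i(n))`
(`siftedLiouvilleCorr`).  So the crux distils into: singles `|S| = 1` (`SiftedSinglesAlong`, sieve-visible), mixed
`|S| ≥ 2` (`SiftedChowlaMixedAlong`, the open parity content: sifted `|S|`-point Chowla along the schedule), the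
parity-free robustness of the row (`RobustRowExp`), and three transfer statements (`GhostFreeLawAlong`,
`CellsNearRankOneAlong`, and the dip line's `FibreHyperbolicityAlong`, glued by the stubs `stub_ghostFreeAlong`,
`stub_rankOneAlong`, `stub_transferAlong`).  Card: `Cruxes/FibreHyperbolicityAlong/Lines/sifted-chowla-distillation.md`;
census: `Cruxes/FibreHyperbolicityAlong/STRATEGY-CENSUS.md`.

Objects: `siftedLiouvilleCorr` (over the sibling line's `NlcCellsAbsoluteClip.roughTuples`), `rowTol`; appended: `rowPoly`.
Appended statements (parity-free residue of the robust row, after wave 1): `ModelLobeMargin`, `ModelZeroGeometry`.  Statements: `SiftedSinglesAlong`, `SiftedChowlaMixedAlong`,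
`RobustRowExp`, `GhostFreeLawAlong`, `CellsNearRankOneAlong`.

References: Green–Tao 2010 §1 [GreenTao2010] (normalisations `β_∞`, `𝔖`); Alladi 1982 [Alladi1982] and
Tenenbaum III.6 [Tenenbaum2015] (Buchstab–Dickman `Ω`-cell densities); Bombieri 1976 [BombieriAsymptoticSieve1976]
(the parity law whose Walsh amplitudes these correlations are).
-/

noncomputable section

namespace Summit.Parity.GeneralizedHardyLittlewood.Cruxes.FibreHyperbolicityAlong.SiftedChowlaDistillation

open scoped BigOperators Classical
open Literature.NumberTheory.Sieve
open Summit.Parity.GeneralizedHardyLittlewood.Theses.LeeYangFibres (CellParityLawSaving)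
open Summit.Parity.GeneralizedHardyLittlewood.Cruxes.AbsoluteUpgrade.DipMarginRateExchange (slowDegree)
open Summit.Parity.GeneralizedHardyLittlewood.Cruxes.ModelHyperbolicity.WindowChainTransport (cellDensity)
open Summit.Parity.GeneralizedHardyLittlewood.Cruxes.FibreHyperbolicity.ModelTransfer (jointCell)
open Summit.Parity.GeneralizedHardyLittlewood.Cruxes.AbsoluteUpgrade.NlcCellsAbsoluteClip (roughTuples)
open Summit.Parity.GeneralizedHardyLittlewood.Theorems.ModelHyperbolicity.Negative (cell)

/-! ## Objects -/

/-- Sifted Liouville correlation `Σ_{n rough tuple} ∏_{i∈S} λ(ψ_i(n))`, `λ = (-1)^Ω` read through `Int.toNat`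
exactly as the cells read `Ω`; the rough tuples are the sibling line's `NlcCellsAbsoluteClip.roughTuples Ψ K N u`
(lattice points of the box with real point in `K` at which EVERY form is `N^{1/u}`-rough — the union over `j` of
the joint cells, tree `Theorems.AbsoluteUpgrade.jointCell_eq_card_filter`). -/
def siftedLiouvilleCorr (t N u : ℕ) (Ψ : Fin t → AffLinForm 1) (K : Set (Fin 1 → ℝ))
    (S : Finset (Fin t)) : ℤ :=
  ∑ n ∈ roughTuples Ψ K N u, ∏ i ∈ S, (-1 : ℤ) ^ ArithmeticFunction.cardFactors ((Ψ i).eval n).toNat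

/-- Row tolerance: relative to `I_m(u) = cellDensity (m-1) u`, with the law-small TOP cell `m = u` (where
`I_u(u) = 0`) measured against `I_{u-1}(u)` instead (same convention as the dip line's `MarginExp`). -/
def rowTol (m u : ℕ) : ℝ := cellDensity (m - 1) u + if m = u then cellDensity (u - 2) u else 0

/-! ## Statements (types of the registered stubs and of their hypotheses; nothing is asserted) -/

/-- **Sifted singles along the schedule** (`|S| = 1`): for every `C`, eventually
`|Σ_{rough tuples} λ(ψ_i(n))| ≤ e^{-C·U(N)} N U(N)^t/(log N)^t`, uniformly over non-degenerate `Ψ` of size `≤ L`,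
convex `K ⊆ [-N,N]`, and `i`.  Sieve-visible (fundamental lemma at `s = U/2 → ∞` on the other forms, level `1/2` for
`E_a`-numbers along one form, anatomy in progressions; the signed Buchstab sum `Σ_m (-1)^m I_m(U) = -ρ(U-1)`);
line statement, type of the registered stub `stub_siftedSinglesAlong`. -/
def SiftedSinglesAlong : Prop :=
  ∀ (t L : ℕ), 1 ≤ t → ∀ C : ℝ, ∃ N₀ : ℕ, ∀ N : ℕ, N₀ ≤ N →
    ∀ Ψ : Fin t → AffLinForm 1, IsNondegenerateSystem Ψ → affLinSize Ψ N ≤ L →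
    ∀ K : Set (Fin 1 → ℝ), Convex ℝ K → K ⊆ realBox 1 N →
    ∀ i : Fin t,
      |(siftedLiouvilleCorr t N (slowDegree N) Ψ K {i} : ℝ)| ≤
        Real.exp (-(C * slowDegree N)) * N * (slowDegree N : ℝ) ^ t / Real.log N ^ t

/-- **Sifted mixed Chowla along the schedule** (`|S| ≥ 2`): the same bound for every sign set with at least two
elements.  THE OPEN PARITY CONTENT OF THE CRUX (census §2): sifted `|S|`-point Chowla at a fixed affine system,
natural density, uniform in shifts `≤ LN`, saving `exp(-C√(log log N)/2)` for every `C`; Siegel-sensitive.  Line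
statement, type of the registered stub `stub_siftedChowlaMixedAlong`. -/
def SiftedChowlaMixedAlong : Prop :=
  ∀ (t L : ℕ), 1 ≤ t → ∀ C : ℝ, ∃ N₀ : ℕ, ∀ N : ℕ, N₀ ≤ N →
    ∀ Ψ : Fin t → AffLinForm 1, IsNondegenerateSystem Ψ → affLinSize Ψ N ≤ L →
    ∀ K : Set (Fin 1 → ℝ), Convex ℝ K → K ⊆ realBox 1 N →
    ∀ S : Finset (Fin t), 2 ≤ S.card →
      |(siftedLiouvilleCorr t N (slowDegree N) Ψ K S : ℝ)| ≤
        Real.exp (-(C * slowDegree N)) * N * (slowDegree N : ℝ) ^ t / Real.log N ^ t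

/-- **Robust row, exponential radius** (PARITY-FREE): for some `C > 0` and all large `u`, every real row `b` with
`|b_j - I_{j+1}(u)| ≤ e^{-Cu}·rowTol (j+1) u` (`j < u`) has only real zeros.  The constructive converse of the
landed `MarginPoly`; numerically the sharp radius is `θ*(u) ≈ 7.5 e^{-0.94u}` (`u ≤ 300`), so the content is
`∃ C ≥ 0.95`.  Line statement, type of the registered stub `stub_robustRowExp`. -/
def RobustRowExp : Prop :=
  ∃ C : ℝ, 0 < C ∧ ∃ u₀ : ℕ, ∀ u : ℕ, u₀ ≤ u → ∀ b : ℕ → ℝ,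
    (∀ j : ℕ, j < u → |b j - cellDensity j u| ≤ Real.exp (-(C * u)) * rowTol (j + 1) u) →
    ∀ z : ℂ, (∑ j ∈ Finset.range u, (b j : ℂ) * z ^ j) = 0 → z.im = 0

/-- **Ghost-free cell law along the schedule**: for every `C` there is `δ > 0` such that eventually, for every
admissible `(Ψ, K)` of singular mass `≥ ηN`, every joint cell `C_j`, `j ∈ [1,U]^t`, is the GHOST-FREE model
`β_∞ 𝔖 ∏_i A_{j_i}(N)/N` (`A_m(N) = cell U N m`) up to relative `e^{-CU}` plus the law's absolute
`N/((log N)^t (log N)^δ)` — the route's `CellParityLawSaving` with every Walsh amplitude `θ_S`, `S ≠ ∅`, clipped to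
`e^{-CU}`.  Line statement, conclusion of the registered stub `stub_ghostFreeAlong` and hypothesis of
`stub_rankOneAlong`. -/
def GhostFreeLawAlong : Prop :=
  ∀ (t L : ℕ), 1 ≤ t → ∀ η : ℝ, 0 < η → ∀ C : ℝ, ∃ δ : ℝ, 0 < δ ∧ ∃ N₀ : ℕ, ∀ N : ℕ, N₀ ≤ N →
    ∀ Ψ : Fin t → AffLinForm 1, IsNondegenerateSystem Ψ → affLinSize Ψ N ≤ L →
    ∀ K : Set (Fin 1 → ℝ), Convex ℝ K → K ⊆ realBox 1 N →
    η * (N : ℝ) ≤ archFactor Ψ K * singularProduct Ψ →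
    ∀ j ∈ Fintype.piFinset (fun _ : Fin t => Finset.Icc 1 (slowDegree N)),
      |(jointCell t N (slowDegree N) Ψ K j : ℝ) -
          archFactor Ψ K * singularProduct Ψ * ∏ i, (cell (slowDegree N) N (j i) : ℝ) / N| ≤
        Real.exp (-(C * slowDegree N)) *
            (archFactor Ψ K * singularProduct Ψ * ∏ i, (cell (slowDegree N) N (j i) : ℝ) / N) +
          (N : ℝ) / (Real.log N ^ t * Real.log N ^ δ)

/-- **Cells near rank one along the schedule**: for every `C`, eventually, every admissible `(Ψ, K)` of singular
mass `≥ ηN` has a scale `M > 0` with `|C_j - M ∏_i I_{j_i}(U)| ≤ e^{-CU} M ∏_i rowTol (j_i) U` for every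
`j ∈ [1,U]^t` (the joint cells are a relative-`e^{-CU}` perturbation of the rank-one Buchstab–Dickman model; top
cells bounded).  Line statement, conclusion of `stub_rankOneAlong` and hypothesis of `stub_transferAlong`. -/
def CellsNearRankOneAlong : Prop :=
  ∀ (t L : ℕ), 1 ≤ t → ∀ η : ℝ, 0 < η → ∀ C : ℝ, ∃ N₀ : ℕ, ∀ N : ℕ, N₀ ≤ N →
    ∀ Ψ : Fin t → AffLinForm 1, IsNondegenerateSystem Ψ → affLinSize Ψ N ≤ L →
    ∀ K : Set (Fin 1 → ℝ), Convex ℝ K → K ⊆ realBox 1 N →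
    η * (N : ℝ) ≤ archFactor Ψ K * singularProduct Ψ →
    ∃ M : ℝ, 0 < M ∧ ∀ j ∈ Fintype.piFinset (fun _ : Fin t => Finset.Icc 1 (slowDegree N)),
      |(jointCell t N (slowDegree N) Ψ K j : ℝ) - M * ∏ i, cellDensity (j i - 1) (slowDegree N)| ≤
        Real.exp (-(C * slowDegree N)) * M * ∏ i, rowTol (j i) (slowDegree N)

/-! ## Small sorry-free API -/

/-- `rowTol m u` unfolds to `I_m(u)` off the top index. -/
theorem rowTol_of_ne {m u : ℕ} (h : m ≠ u) : rowTol m u = cellDensity (m - 1) u := by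
  simp [rowTol, h]

/-- At the top index the tolerance is `I_u(u) + I_{u-1}(u)`. -/
theorem rowTol_self (u : ℕ) : rowTol u u = cellDensity (u - 1) u + cellDensity (u - 2) u := by
  simp [rowTol]

/-- The empty sign set gives the plain count of rough tuples. -/
theorem siftedLiouvilleCorr_empty (t N u : ℕ) (Ψ : Fin t → AffLinForm 1) (K : Set (Fin 1 → ℝ)) :
    siftedLiouvilleCorr t N u Ψ K ∅ = (roughTuples Ψ K N u).card := by
  simp [siftedLiouvilleCorr]

/-- The joint cells of this line (`ModelTransfer.jointCell`, the crux's) and of the sibling vocabulary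
(`NlcCellsAbsoluteClip.jointCell`, used by the tree's Walsh lemmas `Theorems.AbsoluteUpgrade.*`) agree. -/
theorem jointCell_eq_nlc (t N u : ℕ) (Ψ : Fin t → AffLinForm 1) (K : Set (Fin 1 → ℝ)) (j : Fin t → ℕ) :
    jointCell t N u Ψ K j = AbsoluteUpgrade.NlcCellsAbsoluteClip.jointCell Ψ K N u j := rfl

/-! ## The registered bookkeeping stub: the composition of the line (pure logic) -/

/-- **`stub_glueAlong` (registered; pure logic).**  The three transfer stubs compose the four inputs to the crux
in its dip form: `ghostFree law singles mixed` gives `GhostFreeLawAlong`, `rankOne` turns it into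
`CellsNearRankOneAlong`, and `transfer` combines that with `RobustRowExp` into
`DipMarginRateExchange.FibreHyperbolicityAlong` (which is `Iff.rfl`-equal to the route decl
`Theses.LeeYangFibres.FibreHyperbolicityAlong`).  Through it this vocabulary file lands as a `--supports` file
of stmt-Parity-18103 (precedent: `WindowChainTransport.stub_glue`). -/
theorem stub_glueAlong : (CellParityLawSaving → SiftedSinglesAlong → SiftedChowlaMixedAlong → GhostFreeLawAlong) → (GhostFreeLawAlong → CellsNearRankOneAlong) → (CellsNearRankOneAlong → RobustRowExp → AbsoluteUpgrade.DipMarginRateExchange.FibreHyperbolicityAlong) → CellParityLawSaving → SiftedSinglesAlong → SiftedChowlaMixedAlong → RobustRowExp → AbsoluteUpgrade.DipMarginRateExchange.FibreHyperbolicityAlong :=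
  fun hG hA hT hL h1 h2 hR => hT (hA (hG hL h1 h2)) hR

/-! ## Appended (line lead, 2026-08-17, after wave 1): the parity-free residue of `stub_robustRowExp`

Wave 1 reduced `RobustRowExp` sorry-free to a LOBE CERTIFICATE of the Buchstab–Dickman row (`ModelLobeMargin`, the
analytic input that is genuinely missing from the tree: `ModGammaDisc` pins only the `O(1)` zeros near `-1, …, -K`,
`ModelSimple`/`WindowChain` are qualitative), and further to a ZERO-GEOMETRY statement (`ModelZeroGeometry`, the
corrected Conjecture G of card `dickman-dictionary-unit-gaps`) through an elementary margin-from-geometry lemma.  The two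
statements and the row-polynomial object are recorded here (nothing asserted); the reductions land as `--supports` files
(`stub_robustRowOfLobeMargin : ModelLobeMargin → RobustRowExp`, `stub_lobeMarginOfZeroGeometry : ModelZeroGeometry →
ModelLobeMargin`), and `stub_modelLobeMargin : ModelLobeMargin` replaces `stub_robustRowExp` as the line's parity-free
open stub (skeleton v3). -/

section RowResidue

open Polynomial
open Summit.Parity.GeneralizedHardyLittlewood.Cruxes.ModelHyperbolicity.WindowChainTransport (modelPoly)

/-- **Lobe certificate with exponential margin for the Buchstab–Dickman row** (the analytic input of
`stub_robustRowExp`; statement only).  For some `C > 0` and all large `u` there are real test points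
`x_0 > x_1 > ⋯ > x_{u-2}` such that for every `k ≤ u - 2`
`e^{-Cu} · (Σ_{j<u} I_{j+1}(u) |x_k|^j + I_{u-1}(u) |x_k|^{u-1}) < (-1)^k · Σ_{j<u} I_{j+1}(u) x_k^j`
(the extra top term is the tolerance `rowTol u u = I_u(u) + I_{u-1}(u) = I_{u-1}(u)` of the law-small top coefficient).
Numerically: `x_0 = 0`, `x_k` = midpoint of the `k`-th gap of the zeros `-1, -2, …, ≈ -k₀(u), …, ≈ -e^{0.8u}`,
`x_{u-2}` = twice the top zero; shallowest relative lobe depth `θ*(u) ≈ 7.5 e^{-0.94u}` (`u ≤ 300`), so the statement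
is expected for every `C ≳ 2`.  Line statement (type of the registered stub `stub_modelLobeMargin`; hypothesis of
`stub_robustRowOfLobeMargin`). -/
def ModelLobeMargin : Prop :=
  ∃ C : ℝ, 0 < C ∧ ∃ u₀ : ℕ, ∀ u : ℕ, u₀ ≤ u → ∃ x : ℕ → ℝ,
    (∀ k : ℕ, k + 2 < u → x (k + 1) < x k) ∧
    ∀ k : ℕ, k + 1 < u →
      Real.exp (-(C * u)) *
          ((∑ j ∈ Finset.range u, cellDensity j u * |x k| ^ j) +
            cellDensity (u - 2) u * |x k| ^ (u - 1)) <
        (-1) ^ k * ∑ j ∈ Finset.range u, cellDensity j u * x k ^ j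

/-- **Zero geometry of the Buchstab–Dickman row** (Conjecture G of card `dickman-dictionary-unit-gaps`, corrected
and augmented by wave 1; statement only): for some `B` and all large `u` the row polynomial factors as
`modelPoly u = I_{u-1}(u) · ∏_{i<u-2} (X + a_i)` with `0 < a_0 ≤ B`, gaps `a_{i+1} - a_i ≥ 1` and non-decreasing,
and top zero `a_{u-3} ≤ e^{B(u-2)}`.  (The card's `MarginFromGaps` without the normalisation `a_0 ≤ B` and the top
bound is FALSE: `(X+A+1)(X+A+2)`, `A → ∞`.)  Numerically (`u ≤ 31`): `a_i = i + 1` to many digits for `i ≲ u/e`,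
then increasing ratios, top zero `≈ e^{0.8u}`; 0 violations, expected witness `B = 2`.  Line statement (hypothesis of
the registered stub `stub_lobeMarginOfZeroGeometry`). -/
def ModelZeroGeometry : Prop :=
  ∃ B : ℕ, ∃ u₀ : ℕ, ∀ u : ℕ, u₀ ≤ u → ∃ a : ℕ → ℝ,
    0 < a 0 ∧ a 0 ≤ B ∧
    (∀ i : ℕ, i + 1 < u - 2 → 1 ≤ a (i + 1) - a i) ∧
    (∀ i : ℕ, i + 2 < u - 2 → a (i + 1) - a i ≤ a (i + 2) - a (i + 1)) ∧
    a (u - 3) ≤ Real.exp (B * (u - 2 : ℕ)) ∧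
    modelPoly u = C (cellDensity (u - 2) u) * ∏ i ∈ Finset.range (u - 2), (X + C (a i))

/-- The real row polynomial `Σ_{j<u} b_j X^j` of a coefficient row `b` (the object whose zeros `RobustRowExp`
constrains; compare `WindowChainTransport.modelPoly u = rowPoly u (cellDensity · u)`). -/
def rowPoly (u : ℕ) (b : ℕ → ℝ) : ℝ[X] := ∑ j ∈ Finset.range u, C (b j) * X ^ j

/-- Coefficients of `rowPoly u b`. -/
theorem rowPoly_coeff (u : ℕ) (b : ℕ → ℝ) (i : ℕ) :
    (rowPoly u b).coeff i = if i < u then b i else 0 := by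
  unfold rowPoly
  rw [finsetSum_coeff]
  simp only [coeff_C_mul_X_pow]
  rw [Finset.sum_ite_eq]
  simp [Finset.mem_range]

/-- `rowPoly u b` has degree `< u` (for `u ≥ 1`). -/
theorem rowPoly_natDegree_lt {u : ℕ} (hu : 1 ≤ u) (b : ℕ → ℝ) : (rowPoly u b).natDegree < u := by
  have h : (rowPoly u b).natDegree ≤ u - 1 := by
    rw [natDegree_le_iff_coeff_eq_zero]
    intro N hN
    rw [rowPoly_coeff, if_neg (by omega)]
  omega

/-- Real evaluation of `rowPoly u b`. -/
theorem rowPoly_eval (u : ℕ) (b : ℕ → ℝ) (t : ℝ) :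
    (rowPoly u b).eval t = ∑ j ∈ Finset.range u, b j * t ^ j := by
  unfold rowPoly
  rw [eval_finsetSum]
  simp only [eval_mul, eval_C, eval_pow, eval_X]

/-- `rowPoly u b` pushed to `ℂ` evaluates to the complex row sum of `RobustRowExp`. -/
theorem rowPoly_map_eval (u : ℕ) (b : ℕ → ℝ) (z : ℂ) :
    ((rowPoly u b).map (algebraMap ℝ ℂ)).eval z = ∑ j ∈ Finset.range u, (b j : ℂ) * z ^ j := by
  unfold rowPoly
  rw [Polynomial.map_sum, eval_finsetSum]
  simp only [Polynomial.map_mul, Polynomial.map_C, Polynomial.map_pow, Polynomial.map_X, eval_mul, eval_C,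
    eval_pow, eval_X, Complex.coe_algebraMap]

/-- **`stub_rowGlue` (registered; pure logic).**  The parity-free residue composes: a proof of the lobe certificate
and the reduction `ModelLobeMargin → RobustRowExp` give the row robustness consumed by `stub_transferAlong`. -/
theorem stub_rowGlue : (ModelLobeMargin → RobustRowExp) → ModelLobeMargin → RobustRowExp :=
  fun h hm => h hm

end RowResidue

end Summit.Parity.GeneralizedHardyLittlewood.Cruxes.FibreHyperbolicityAlong.SiftedChowlaDistillation

end
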